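import Mathlib
import Summits.Ventures.PercRepro2.TwoHullMasterPathRuns

/-!
# The two-hull master statement on a path (blind cell PercRepro2, night-4 g39, 2026-08-29;
proofs/NIGHT4-G39.md §7) — part II

(MM) of TwoHullMaster.lean holds on the path `p 0 – p 1 – ⋯ – p k` with `l = p 0` and `h = p k`:
**`twoHullMaster_path`**.  With the runs and the interface involution `flipHead` of part I
(TwoHullMasterPathRuns.lean): for `Φ = X·Y`, `X = 1[𝓦l] − 1[mirror 𝓦l]` at `l` (its sign is the
colour of the first run — the diamond: a pair `(A, {l})` dominates its swap) and `Y` likewise at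
`h`, every non-constant word satisfies `Φ ζ + Φ (flipHead ζ) ≤ 0` (`phi_add_phi_flipHead_nonpos`):
the pair of `l` mirrors, so the sum is `X·(Y − Y′)`, and the pair of `h` is unchanged (interior),
moves up exactly when `X ≥ 0` (the tail has the colour of a red first run, or the blue mismatch
run shrinks), moves down exactly when `X ≤ 0`, or mirrors with `X·Y ≤ 0` (the mismatch is the last
edge).  Summing over the involution, `2 Σ_U Φ ≤ 0` (`sum_phi_nonpos`); `Σ_U Φ` is the alternating
sum of the four two-hull counts (`sum_phi_eq`), which the swap identities of TwoHullMaster.lean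
reduce to `2 (#{U, 𝓦l, 𝓦h} − #{U, 𝓦l, mirror 𝓦h})`.  The first graph family on which the typed
conjecture (MM) is a kernel theorem; the paper proof (NIGHT4-G39.md §7) covers the path with
arbitrary graphs attached at `l` and at `h`.
-/

namespace Summit.Ventures.PercRepro2

namespace Path2

open Hull LocRows

open scoped Classical

variable {V : Type*} {k : ℕ} {p : Fin (k + 1) → V}

/-! ## §5 Signs of pairs under an up-set -/

section Signs

variable {𝓦 : Set (Set V × Set V)}

/-- The indicator of an up-set of pairs. -/
noncomputable def ind (𝓦 : Set (Set V × Set V)) (q : Set V × Set V) : ℤ := if q ∈ 𝓦 then 1 else 0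

/-- The sign of a pair: the indicator minus the indicator of the swap. -/
noncomputable def sgn (𝓦 : Set (Set V × Set V)) (q : Set V × Set V) : ℤ := ind 𝓦 q - ind 𝓦 q.swap

/-- The pair order: the first coordinate grows, the second shrinks. -/
def PairLE (q q' : Set V × Set V) : Prop := q.1 ⊆ q'.1 ∧ q'.2 ⊆ q.2

/-- The swap reverses the pair order. -/
lemma PairLE.swap {q q' : Set V × Set V} (h : PairLE q q') : PairLE q'.swap q.swap := ⟨h.2, h.1⟩

/-- The indicator of an up-set is monotone. -/
lemma ind_mono (h𝓦 : IsPairUpSet 𝓦) {q q' : Set V × Set V} (h : PairLE q q') :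
    ind 𝓦 q ≤ ind 𝓦 q' := by
  simp only [ind]
  split_ifs with h1 h2
  · exact le_rfl
  · exact absurd (h𝓦 _ _ _ _ h.1 h.2 h1) h2
  · norm_num
  · exact le_rfl

/-- The sign of the swap is the opposite sign. -/
lemma sgn_swap (q : Set V × Set V) : sgn 𝓦 q.swap = - sgn 𝓦 q := by
  simp only [sgn, Prod.swap_swap]; ring

/-- The sign is monotone in the pair order. -/
lemma sgn_mono (h𝓦 : IsPairUpSet 𝓦) {q q' : Set V × Set V} (h : PairLE q q') :
    sgn 𝓦 q ≤ sgn 𝓦 q' := by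
  simp only [sgn]
  have h1 := ind_mono h𝓦 h
  have h2 := ind_mono h𝓦 h.swap
  omega

/-- A pair dominating its swap has a nonnegative sign. -/
lemma sgn_nonneg (h𝓦 : IsPairUpSet 𝓦) {q : Set V × Set V} (h : PairLE q.swap q) : 0 ≤ sgn 𝓦 q := by
  simp only [sgn]
  have := ind_mono h𝓦 h
  omega

/-- A pair dominated by its swap has a nonpositive sign. -/
lemma sgn_nonpos (h𝓦 : IsPairUpSet 𝓦) {q : Set V × Set V} (h : PairLE q q.swap) : sgn 𝓦 q ≤ 0 := by
  simp only [sgn]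
  have := ind_mono h𝓦 h
  omega

end Signs

/-! ## §6 The interface inequality -/

section Key

variable (p) (𝓦l 𝓦h : Set (Set V × Set V))

/-- The signed summand `X·Y` of a configuration. -/
noncomputable def phi (ζ : Config (Fin k)) : ℤ :=
  sgn 𝓦l (hullPair (pathEnds p) ζ (p 0)) * sgn 𝓦h (hullPair (pathEnds p) ζ (p (Fin.last k)))

variable {p 𝓦l 𝓦h}

/-- The hull pair of `p 0` mirrors under `flipHead`. -/
lemma hullPair_zero_flipHead (hp : Function.Injective p) {ζ : Config (Fin k)} (hc : ¬ IsConst ζ) :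
    hullPair (pathEnds p) (flipHead ζ) (p 0) = (hullPair (pathEnds p) ζ (p 0)).swap := by
  obtain ⟨r, hr, j₀, hj₀, hne⟩ := exists_first_mismatch hc
  rw [hullPair_zero hp, hullPair_zero hp]
  simp only [Prod.swap]
  congr 1
  · exact pathSet_congr fun v => by rw [pre_flipHead_iff hr hj₀ hne]; rfl
  · exact pathSet_congr fun v => by rw [pre_flipHead_iff hr hj₀ hne]; rfl

/-- **The interface inequality**: `Φ ζ + Φ (flipHead ζ) ≤ 0` for every non-constant word. -/
theorem phi_add_phi_flipHead_nonpos (hp : Function.Injective p) (h𝓦l : IsPairUpSet 𝓦l)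
    (h𝓦h : IsPairUpSet 𝓦h) {ζ : Config (Fin k)} (hc : ¬ IsConst ζ) :
    phi p 𝓦l 𝓦h ζ + phi p 𝓦l 𝓦h (flipHead ζ) ≤ 0 := by
  obtain ⟨r, hr, j₀, hj₀, hne⟩ := exists_first_mismatch hc
  have hk : 0 < k := lt_of_le_of_lt (Nat.zero_le _) r.isLt
  have h0r : (⟨0, hk⟩ : Fin k) < r := Fin.lt_def.2 (by have := Fin.lt_def.1 hj₀; simp; omega)
  -- the pairs
  set ql := hullPair (pathEnds p) ζ (p 0) with hql
  set t := hullPair (pathEnds p) ζ (p (Fin.last k)) with ht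
  set t' := hullPair (pathEnds p) (flipHead ζ) (p (Fin.last k)) with ht'
  have hl' : hullPair (pathEnds p) (flipHead ζ) (p 0) = ql.swap := hullPair_zero_flipHead hp hc
  have hsum : phi p 𝓦l 𝓦h ζ + phi p 𝓦l 𝓦h (flipHead ζ) =
      sgn 𝓦l ql * (sgn 𝓦h t - sgn 𝓦h t') := by
    simp only [phi, hl', sgn_swap, ← hql, ← ht, ← ht']; ring
  rw [hsum]
  -- the sign of `X` is the colour of the first run
  have hX0 : ζ r = false → 0 ≤ sgn 𝓦l ql := by
    intro hζr
    refine sgn_nonneg h𝓦l ?_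
    rw [hql, hullPair_zero hp]
    have hsub : pathSet p (Pre ζ false) ⊆ pathSet p (Pre ζ true) := by
      refine pathSet_mono fun v hv i hi => ?_
      exfalso
      have h0 := hv ⟨0, hk⟩ (by show (0 : ℕ) < (v : ℕ); omega)
      rw [eq_not_of_lt hr hj₀ hne h0r, hζr] at h0
      simp at h0
    exact ⟨hsub, hsub⟩
  have hX1 : ζ r = true → sgn 𝓦l ql ≤ 0 := by
    intro hζr
    refine sgn_nonpos h𝓦l ?_
    rw [hql, hullPair_zero hp]
    have hsub : pathSet p (Pre ζ true) ⊆ pathSet p (Pre ζ false) := by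
      refine pathSet_mono fun v hv i hi => ?_
      exfalso
      have h0 := hv ⟨0, hk⟩ (by show (0 : ℕ) < (v : ℕ); omega)
      rw [eq_not_of_lt hr hj₀ hne h0r, hζr] at h0
      simp at h0
    exact ⟨hsub, hsub⟩
  -- the behaviour of the pair of `h`
  rw [ht, ht', hullPair_last hp, hullPair_last hp]
  by_cases hlast : ∀ i : Fin k, ¬ r < i
  · -- (D) the mismatch is the last edge: the pair of `h` mirrors
    have hmir : (pathSet p (Suf (flipHead ζ) true), pathSet p (Suf (flipHead ζ) false)) =
        (pathSet p (Suf ζ true), pathSet p (Suf ζ false)).swap := by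
      simp only [Prod.swap]
      congr 1
      · exact pathSet_congr fun v => by rw [suf_flipHead_iff_of_last hr hj₀ hne hlast]; rfl
      · exact pathSet_congr fun v => by rw [suf_flipHead_iff_of_last hr hj₀ hne hlast]; rfl
    rw [hmir, sgn_swap]
    cases hζr : ζ r with
    | false =>
      have hX := hX0 hζr
      have hY : sgn 𝓦h (pathSet p (Suf ζ true), pathSet p (Suf ζ false)) ≤ 0 := by
        refine sgn_nonpos h𝓦h ?_
        have hsub : pathSet p (Suf ζ true) ⊆ pathSet p (Suf ζ false) := by
          refine pathSet_mono fun v hv i hi => ?_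
          exfalso
          have hir : i ≤ r := not_lt.1 (hlast i)
          have := hv r (by have := Fin.le_def.1 hir; omega)
          rw [hζr] at this
          simp at this
        exact ⟨hsub, hsub⟩
      nlinarith
    | true =>
      have hX := hX1 hζr
      have hY : 0 ≤ sgn 𝓦h (pathSet p (Suf ζ true), pathSet p (Suf ζ false)) := by
        refine sgn_nonneg h𝓦h ?_
        have hsub : pathSet p (Suf ζ false) ⊆ pathSet p (Suf ζ true) := by
          refine pathSet_mono fun v hv i hi => ?_
          exfalso
          have hir : i ≤ r := not_lt.1 (hlast i)
          have := hv r (by have := Fin.le_def.1 hir; omega)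
          rw [hζr] at this
          simp at this
        exact ⟨hsub, hsub⟩
      nlinarith
  · obtain ⟨i₁, hi₁⟩ : ∃ i : Fin k, r < i := by
      by_contra h'
      exact hlast fun i hi => h' ⟨i, hi⟩
    by_cases hT1 : Tail ζ r (!ζ r)
    · -- (B) the tail has the colour of the first run
      cases hζr : ζ r with
      | false =>
        have hX := hX0 hζr
        have hle : PairLE (pathSet p (Suf ζ true), pathSet p (Suf ζ false))
            (pathSet p (Suf (flipHead ζ) true), pathSet p (Suf (flipHead ζ) false)) := by
          refine ⟨pathSet_mono fun v hv => ?_, pathSet_mono fun v hv => ?_⟩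
          · have := suf_mono_of_tail_first hr hj₀ hne v (by rw [hζr]; exact hv)
            rwa [hζr] at this
          · have := (suf_flipHead_iff_of_tail_first hr hj₀ hne hT1 hi₁ v).1 (by rw [hζr]; exact hv)
            rwa [hζr] at this
        have hY := sgn_mono h𝓦h hle
        nlinarith
      | true =>
        have hX := hX1 hζr
        have hle : PairLE (pathSet p (Suf (flipHead ζ) true), pathSet p (Suf (flipHead ζ) false))
            (pathSet p (Suf ζ true), pathSet p (Suf ζ false)) := by
          refine ⟨pathSet_mono fun v hv => ?_, pathSet_mono fun v hv => ?_⟩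
          · have := (suf_flipHead_iff_of_tail_first hr hj₀ hne hT1 hi₁ v).1 (by rw [hζr]; exact hv)
            rwa [hζr] at this
          · have := suf_mono_of_tail_first hr hj₀ hne v (by rw [hζr]; exact hv)
            rwa [hζr] at this
        have hY := sgn_mono h𝓦h hle
        nlinarith
    · by_cases hT2 : Tail ζ r (ζ r)
      · -- (C) the tail has the colour of the mismatch edge
        cases hζr : ζ r with
        | false =>
          have hX := hX0 hζr
          have hle : PairLE (pathSet p (Suf ζ true), pathSet p (Suf ζ false))
              (pathSet p (Suf (flipHead ζ) true), pathSet p (Suf (flipHead ζ) false)) := by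
            refine ⟨pathSet_mono fun v hv => ?_, pathSet_mono fun v hv => ?_⟩
            · have := (suf_flipHead_iff_of_tail_mismatch hr hj₀ hne hT2 hi₁ v).2
                (by rw [hζr]; exact hv)
              rwa [hζr] at this
            · have := suf_anti_of_tail_mismatch hr hj₀ hne v (by rw [hζr]; exact hv)
              rwa [hζr] at this
          have hY := sgn_mono h𝓦h hle
          nlinarith
        | true =>
          have hX := hX1 hζr
          have hle : PairLE (pathSet p (Suf (flipHead ζ) true), pathSet p (Suf (flipHead ζ) false))
              (pathSet p (Suf ζ true), pathSet p (Suf ζ false)) := by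
            refine ⟨pathSet_mono fun v hv => ?_, pathSet_mono fun v hv => ?_⟩
            · have := suf_anti_of_tail_mismatch hr hj₀ hne v (by rw [hζr]; exact hv)
              rwa [hζr] at this
            · have := (suf_flipHead_iff_of_tail_mismatch hr hj₀ hne hT2 hi₁ v).2
                (by rw [hζr]; exact hv)
              rwa [hζr] at this
          have hY := sgn_mono h𝓦h hle
          nlinarith
      · -- (A) the tail is not constant: the pair of `h` is unchanged
        have hT : ∀ d, ¬ Tail ζ r d := by
          intro d
          cases d <;> cases hζr : ζ r <;> simp_all
        have heq : (pathSet p (Suf (flipHead ζ) true), pathSet p (Suf (flipHead ζ) false)) =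
            (pathSet p (Suf ζ true), pathSet p (Suf ζ false)) := by
          congr 1
          · exact pathSet_congr fun v => suf_flipHead_iff_of_not_tail hr hj₀ hne hT true v
          · exact pathSet_congr fun v => suf_flipHead_iff_of_not_tail hr hj₀ hne hT false v
        rw [heq]
        simp

end Key

/-! ## §7 The sum over the non-constant words and the count inequality -/

section Sum

variable (p) (𝓦l 𝓦h : Set (Set V × Set V))

/-- The non-constant words. -/
noncomputable def nonConst (k : ℕ) : Finset (Config (Fin k)) :=
  Finset.univ.filter fun ζ : Config (Fin k) => ¬ IsConst ζ

variable {p 𝓦l 𝓦h}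

/-- Membership in the non-constant words. -/
lemma mem_nonConst {ζ : Config (Fin k)} : ζ ∈ nonConst k ↔ ¬ IsConst ζ := by
  simp only [nonConst, Finset.mem_filter, Finset.mem_univ, true_and]

/-- **The signed sum over the non-constant words is non-positive.** -/
theorem sum_phi_nonpos (hp : Function.Injective p) (h𝓦l : IsPairUpSet 𝓦l)
    (h𝓦h : IsPairUpSet 𝓦h) : ∑ ζ ∈ nonConst k, phi p 𝓦l 𝓦h ζ ≤ 0 := by
  have hflip : ∑ ζ ∈ nonConst k, phi p 𝓦l 𝓦h (flipHead ζ) = ∑ ζ ∈ nonConst k, phi p 𝓦l 𝓦h ζ := by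
    refine Finset.sum_nbij' flipHead flipHead ?_ ?_ ?_ ?_ ?_
    · intro ζ hζ
      rw [mem_nonConst] at hζ ⊢
      exact not_isConst_flipHead hζ
    · intro ζ hζ
      rw [mem_nonConst] at hζ ⊢
      exact not_isConst_flipHead hζ
    · intro ζ _; exact flipHead_flipHead ζ
    · intro ζ _; exact flipHead_flipHead ζ
    · intro ζ _; rfl
  have h2 : 2 * ∑ ζ ∈ nonConst k, phi p 𝓦l 𝓦h ζ =
      ∑ ζ ∈ nonConst k, (phi p 𝓦l 𝓦h ζ + phi p 𝓦l 𝓦h (flipHead ζ)) := by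
    rw [Finset.sum_add_distrib, hflip]; ring
  have h3 : ∑ ζ ∈ nonConst k, (phi p 𝓦l 𝓦h ζ + phi p 𝓦l 𝓦h (flipHead ζ)) ≤ 0 := by
    refine Finset.sum_nonpos fun ζ hζ => ?_
    rw [mem_nonConst] at hζ
    exact phi_add_phi_flipHead_nonpos hp h𝓦l h𝓦h hζ
  omega

/-- The two-hull class of the path is the filtered set of non-constant words. -/
lemma twoHullClass_path_eq (hp : Function.Injective p) (𝓦l 𝓦h : Set (Set V × Set V)) :
    twoHullClass (pathEnds p) (p 0) (p (Fin.last k)) 𝓦l 𝓦h =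
      (nonConst k).filter fun ζ =>
        hullPair (pathEnds p) ζ (p 0) ∈ 𝓦l ∧ hullPair (pathEnds p) ζ (p (Fin.last k)) ∈ 𝓦h := by
  ext ζ
  rw [mem_twoHullClass, Finset.mem_filter, mem_nonConst, last_notMem_hull_iff hp]

/-- The product of two indicators is the indicator of the conjunction. -/
lemma ind_mul_ind (𝓦 𝓦' : Set (Set V × Set V)) (q t : Set V × Set V) :
    ind 𝓦 q * ind 𝓦' t = if (q ∈ 𝓦 ∧ t ∈ 𝓦') then 1 else 0 := by
  simp only [ind]
  split_ifs <;> simp_all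

/-- The indicator of the swap is the indicator of the mirror. -/
lemma ind_swap (𝓦 : Set (Set V × Set V)) (q : Set V × Set V) : ind 𝓦 q.swap = ind (mirror 𝓦) q :=
  rfl

/-- The signed sum in terms of the four two-hull counts. -/
lemma sum_phi_eq (hp : Function.Injective p) (𝓦l 𝓦h : Set (Set V × Set V)) :
    ∑ ζ ∈ nonConst k, phi p 𝓦l 𝓦h ζ =
      ((twoHullClass (pathEnds p) (p 0) (p (Fin.last k)) 𝓦l 𝓦h).card : ℤ)
        - ((twoHullClass (pathEnds p) (p 0) (p (Fin.last k)) 𝓦l (mirror 𝓦h)).card : ℤ)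
        - ((twoHullClass (pathEnds p) (p 0) (p (Fin.last k)) (mirror 𝓦l) 𝓦h).card : ℤ)
        + ((twoHullClass (pathEnds p) (p 0) (p (Fin.last k)) (mirror 𝓦l) (mirror 𝓦h)).card : ℤ) := by
  have key : ∀ ζ, phi p 𝓦l 𝓦h ζ =
      (if (hullPair (pathEnds p) ζ (p 0) ∈ 𝓦l ∧ hullPair (pathEnds p) ζ (p (Fin.last k)) ∈ 𝓦h)
        then (1 : ℤ) else 0)
      - (if (hullPair (pathEnds p) ζ (p 0) ∈ 𝓦l ∧
          hullPair (pathEnds p) ζ (p (Fin.last k)) ∈ mirror 𝓦h) then (1 : ℤ) else 0)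
      - (if (hullPair (pathEnds p) ζ (p 0) ∈ mirror 𝓦l ∧
          hullPair (pathEnds p) ζ (p (Fin.last k)) ∈ 𝓦h) then (1 : ℤ) else 0)
      + (if (hullPair (pathEnds p) ζ (p 0) ∈ mirror 𝓦l ∧
          hullPair (pathEnds p) ζ (p (Fin.last k)) ∈ mirror 𝓦h) then (1 : ℤ) else 0) := by
    intro ζ
    simp only [phi, sgn, ind_swap]
    rw [← ind_mul_ind, ← ind_mul_ind, ← ind_mul_ind, ← ind_mul_ind]
    ring
  simp_rw [key]
  rw [Finset.sum_add_distrib, Finset.sum_sub_distrib, Finset.sum_sub_distrib]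
  simp only [Finset.sum_boole, twoHullClass_path_eq hp]

/-- **(MM) on the path** `p 0 – ⋯ – p k`, `l = p 0`, `h = p k`. -/
theorem twoHullMaster_path (hp : Function.Injective p) :
    TwoHullMaster (pathEnds p) (p 0) (p (Fin.last k)) := by
  intro 𝓦l 𝓦h h𝓦l h𝓦h
  have hsum := sum_phi_nonpos hp h𝓦l h𝓦h
  rw [sum_phi_eq hp] at hsum
  have e1 := card_twoHullClass_mirror_mirror (ends := pathEnds p) (p 0) (p (Fin.last k)) 𝓦l 𝓦h
  have e2 := card_twoHullClass_mirror_mirror (ends := pathEnds p) (p 0) (p (Fin.last k)) 𝓦l (mirror 𝓦h)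
  rw [mirror_mirror] at e2
  omega

end Sum

end Path2

end Summit.Ventures.PercRepro2
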